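import Summits.BirchSwinnertonDyer.Rank1Residual.Partition.EisensteinKernelReductionLine
import Literature.NumberTheory.EllipticCurves.Rank1Residual.GVParityLineTypeProofs
import HarnessLib

/-!
# The Greenberg–Vatsal type at a GOOD ORDINARY odd `p` DECIDED from one kernel point:
# `GVPar W p ↔ (v_𝔓(x) > 1 ↔ Ψ₂Sq(x) > 0)` — type B iff (ramified ∧ even) ∨ (unramified ∧ odd)

HONEST FRAMING (cell `b2b-bsdres-*`, verbatim): the goal of the cell is to DELETE the
COMBINATION-SHAPED residual classes for ALL analytic-rank ≤ 1 curves over ℚ — "full BSD formula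
for every rank ≤ 1 curve in class C" assembled STRICTLY from published theorems — so that the
rank-≤1 remainder becomes exactly the CONSTRUCTION-SHAPED classes, which are TYPED (missing-input
Props), NOT attempted; this is not "finishing BSD". Off-peak literature typer `b2b-bsdres-lit-cgls`
(CGLS22 / GV00, the reducible = Eisenstein column), session 14, file 3: theorems only, no
definition, no named fact, nothing booked, no label changed.

WHY. Files 1–2 (`EisensteinKernelRealPoints`, `EisensteinKernelReductionLine`) turned the two steps
of the lane's decision procedure of record for `GVPar` (bsdN/HYPOTHESES.md row T-GV0: kernel
polynomial NOT `p`-integral ⇔ ramified; sign of `f = 4x³ + b₂x² + 2b₄x + b₆` at the kernel abscissas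
⇔ parity) into theorems about ONE rational line `Φ`. Greenberg–Vatsal's hypothesis quantifies over
ALL rational `p`-isogeny kernels; at a good ordinary odd `p` the type does not depend on the kernel
(x1a, `Rank1Residual.gvType_iff_of_isRationalLine` / `not_gvPar_of_isRationalLine`, from Serre's
ordinary line and a complex conjugation). Hence the full dictionary entry, the analogue at every good
ordinary odd `p` of session 13's `KernelDisc.gvPar_three_iff_abscissa_of_goodOrd`
(`GVPar W 3 ↔ (0 < b₂ + 12x₀ ↔ den x₀ ≠ 1)`):

* `gvType_iff_gvPar_of_goodOrd` — for ANY rational line `Φ`: `GVPar W p` iff `Φ` itself is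
  (ramified ∧ even) ∨ (unramified ∧ odd);
* **`gvPar_iff_valuation_iff_re_pos`** / **`gvPar_iff_valuation_iff_aeval_real_pos`** — for any
  non-zero `P = (x, y) ∈ Φ`, the place `𝔓 = placeOver p` and the embedding `ι` of a complex
  conjugation (`ι x = r ∈ ℝ`): **`GVPar W p ↔ (1 < v_𝔓(x) ↔ 0 < Ψ₂Sq(r))`** — type B iff "abscissa
  non-integral at `𝔓`" and "point real" agree; `gvPar_iff_of_anom_abscissa` — the same on class X1
  (`Anom W p` ⇒ good ordinary, `goodOrd_of_anom`);
* TYPE-A CERTIFICATES (class N1 = X1 ∧ ¬gvpar bookkeeping): `not_gvPar_of_one_lt_valuation_of_forall_real_root_neg`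
  (a ramified ODD line ⇒ type A), `not_gvPar_of_valuation_le_one_of_forall_real_root_pos` (an
  unramified EVEN line ⇒ type A), complementing file 2's type-B certificates
  `gvPar_of_one_lt_valuation_of_forall_real_root_pos` / `gvPar_of_valuation_le_one_of_forall_real_root_neg`;
  `one_lt_valuation_of_pow_mul_eq` / `not_lineUnramifiedAt_of_pow_mul_eq` — the ramified
  (non-`𝔓`-integral) certificate in POWER form `x^k·p·s = d` (`s` integral, `p ∤ d`), the shape met by
  canonical-subgroup abscissas at `p ≥ 5` (`|x|_𝔓 = |p|^{−2/(p−1)}`, `k = p − 1`).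

References: R. Greenberg, V. Vatsal, Invent. Math. 142 (2000), Thm. 1.3 [GreenbergVatsal2000];
J.-P. Serre, Invent. Math. 15 (1972) §1.11 [Serre1972]; J. H. Silverman, *AEC* (2009) III.2.3,
VII.2.1 [SilvermanAEC2009]; bsdN/HYPOTHESES.md row T-GV0; HOME/b2b-bsdres-lit-cgls/CGLS-GV-TYPING.md §21.
-/

set_option autoImplicit false

noncomputable section

open scoped Classical NumberField ComplexConjugate

open WeierstrassCurve Polynomial Literature.NumberTheory.EllipticCurves
  Literature.NumberTheory.EllipticCurves.Rank1Residual Literature.NumberTheory.GaloisRepresentations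
  Field

namespace Summit.BirchSwinnertonDyer.Rank1Residual

namespace KernelDisc

variable {W : WeierstrassCurve ℚ} [W.IsElliptic] [W.IsGloballyMinimal] {p : ℕ} [Fact p.Prime]
  {Φ : AddSubgroup (geomTorsion W (p : ℤ))}

/-- **`GVPar` is the type of ANY rational line** (good ordinary odd `p`): `GVPar W p` iff `Φ` is
(ramified ∧ even) ∨ (unramified ∧ odd) — the type does not depend on the kernel
(`not_gvPar_of_isRationalLine`). [folklore] -/
theorem gvType_iff_gvPar_of_goodOrd (hΦ : IsRationalLine W p Φ) (hp2 : p ≠ 2)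
    (hgood : W.HasGoodReductionAtPrime p) (hord : ¬ (p : ℤ) ∣ W.frobeniusTrace p) :
    ((¬ LineUnramifiedAt W p Φ ∧ LineEven W p Φ) ∨ (LineUnramifiedAt W p Φ ∧ LineOdd W p Φ)) ↔
      GVPar W p :=
  ⟨fun h ↦ ⟨Φ, hΦ, h⟩, fun hB ↦ by
    by_contra h
    exact not_gvPar_of_isRationalLine hp2 hgood hord hΦ h hB⟩

/-- **The Greenberg–Vatsal type decided from one kernel point.** Let `E/ℚ` be given by a globally
minimal `W` with good ordinary reduction at the odd prime `p`, `Φ ≤ E[p]` ANY rational line,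
`P = (x, y) ∈ Φ` non-zero, `c` a complex conjugation with embedding `ι : ℚ̄ → ℂ`. Then
`GVPar W p ↔ (1 < v_𝔓(x) ↔ 0 < Re ι(Ψ₂Sq(x)))`: type B iff the abscissa is non-`𝔓`-integral
exactly when the point is real. [folklore] -/
theorem gvPar_iff_valuation_iff_re_pos (hΦ : IsRationalLine W p Φ) (hp2 : p ≠ 2)
    (hgood : W.HasGoodReductionAtPrime p) (hord : ¬ (p : ℤ) ∣ W.frobeniusTrace p)
    {P : geomTorsion W (p : ℤ)} (hPΦ : P ∈ Φ) (hP0 : P ≠ 0)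
    {x y : AlgebraicClosure ℚ} {h : (W.baseChange (AlgebraicClosure ℚ)).toAffine.Nonsingular x y}
    (hP : (P : W.geomPoints) = Affine.Point.some x y h)
    {c : absoluteGaloisGroup ℚ} (hc : IsComplexConjugation (Rat.castHom ℝ) c)
    {ι : AlgebraicClosure ℚ →+* ℂ} (hι : ∀ z, ι (c • z) = conj (ι z)) :
    GVPar W p ↔ (1 < (placeOver p).valuation x ↔ 0 < (ι (aeval x W.Ψ₂Sq)).re) := by
  rw [← gvType_iff_gvPar_of_goodOrd hΦ hp2 hgood hord,
    not_lineUnramifiedAt_iff_one_lt_valuation hΦ hp2 hgood hord hPΦ hP0 hP,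
    lineUnramifiedAt_iff_valuation_le_one hΦ hp2 hgood hord hPΦ hP0 hP,
    lineEven_iff_re_pos hΦ hp2 hPΦ hP0 hP hc hι, lineOdd_iff_re_neg hΦ hp2 hPΦ hP0 hP hc hι]
  -- `Re ι(Ψ₂Sq(x)) ≠ 0`: it is `> 0` or `< 0` according to the parity of `Φ`
  have hne : (ι (aeval x W.Ψ₂Sq)).re ≠ 0 := by
    rcases lineEven_or_lineOdd hΦ with he | ho
    · exact (re_pos_of_lineEven hΦ hp2 hPΦ hP0 hP hc hι he).1.ne'
    · exact (re_neg_of_lineOdd hΦ hp2 hPΦ hP0 hP hc hι ho).1.ne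
  constructor
  · rintro (⟨hv, hs⟩ | ⟨hv, hs⟩)
    · exact ⟨fun _ ↦ hs, fun _ ↦ hv⟩
    · exact ⟨fun hv' ↦ absurd hv (not_le.mpr hv'), fun hs' ↦ absurd hs (not_lt.mpr hs'.le)⟩
  · intro hiff
    by_cases hv : 1 < (placeOver p).valuation x
    · exact Or.inl ⟨hv, hiff.mp hv⟩
    · refine Or.inr ⟨not_lt.mp hv, ?_⟩
      rcases lt_trichotomy ((ι (aeval x W.Ψ₂Sq)).re) 0 with hlt | heq | hgt
      · exact hlt
      · exact absurd heq hne
      · exact absurd (hiff.mpr hgt) hv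

/-- **Real-root form**: with `ι x = r ∈ ℝ` (`exists_abscissa_eq_ofReal`),
`GVPar W p ↔ (1 < v_𝔓(x) ↔ 0 < Ψ₂Sq(r))`, the value computed in `ℝ`. [folklore] -/
theorem gvPar_iff_valuation_iff_aeval_real_pos (hΦ : IsRationalLine W p Φ) (hp2 : p ≠ 2)
    (hgood : W.HasGoodReductionAtPrime p) (hord : ¬ (p : ℤ) ∣ W.frobeniusTrace p)
    {P : geomTorsion W (p : ℤ)} (hPΦ : P ∈ Φ) (hP0 : P ≠ 0)
    {x y : AlgebraicClosure ℚ} {h : (W.baseChange (AlgebraicClosure ℚ)).toAffine.Nonsingular x y}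
    (hP : (P : W.geomPoints) = Affine.Point.some x y h)
    {c : absoluteGaloisGroup ℚ} (hc : IsComplexConjugation (Rat.castHom ℝ) c)
    {ι : AlgebraicClosure ℚ →+* ℂ} (hι : ∀ z, ι (c • z) = conj (ι z)) {r : ℝ} (hr : ι x = r) :
    GVPar W p ↔ (1 < (placeOver p).valuation x ↔ 0 < aeval r W.Ψ₂Sq) := by
  rw [gvPar_iff_valuation_iff_re_pos hΦ hp2 hgood hord hPΦ hP0 hP hc hι, map_aeval_eq, hr,
    eval₂_ofReal_eq, Complex.ofReal_re]

/-- **Class X1 form**: at an anomalous Eisenstein prime of good reduction `p ≠ 2` (`Anom W p`, hence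
good ordinary, `goodOrd_of_anom`), `GVPar W p ↔ (1 < v_𝔓(x) ↔ 0 < Ψ₂Sq(r))` for any rational line
and any of its non-zero points — the N1 (type A) / N1′ (type B) split read off one kernel point.
[folklore] -/
theorem gvPar_iff_of_anom_abscissa (hΦ : IsRationalLine W p Φ) (hp2 : p ≠ 2) (hA : Anom W p)
    {P : geomTorsion W (p : ℤ)} (hPΦ : P ∈ Φ) (hP0 : P ≠ 0)
    {x y : AlgebraicClosure ℚ} {h : (W.baseChange (AlgebraicClosure ℚ)).toAffine.Nonsingular x y}
    (hP : (P : W.geomPoints) = Affine.Point.some x y h)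
    {c : absoluteGaloisGroup ℚ} (hc : IsComplexConjugation (Rat.castHom ℝ) c)
    {ι : AlgebraicClosure ℚ →+* ℂ} (hι : ∀ z, ι (c • z) = conj (ι z)) {r : ℝ} (hr : ι x = r) :
    GVPar W p ↔ (1 < (placeOver p).valuation x ↔ 0 < aeval r W.Ψ₂Sq) :=
  gvPar_iff_valuation_iff_aeval_real_pos hΦ hp2 (goodOrd_of_anom W p hA).1 (goodOrd_of_anom W p hA).2
    hPΦ hP0 hP hc hι hr

/-! ### Type-A certificates (class N1 bookkeeping) -/

/-- **Type A from a RAMIFIED ODD line**: `v_𝔓(x) > 1` and `Ψ₂Sq < 0` at every real root of an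
`F ∈ ℚ[X]` vanishing at `x` ⇒ `¬ GVPar W p` (good ordinary odd `p`). [folklore] -/
theorem not_gvPar_of_one_lt_valuation_of_forall_real_root_neg (hΦ : IsRationalLine W p Φ)
    (hp2 : p ≠ 2) (hgood : W.HasGoodReductionAtPrime p) (hord : ¬ (p : ℤ) ∣ W.frobeniusTrace p)
    {P : geomTorsion W (p : ℤ)} (hPΦ : P ∈ Φ) (hP0 : P ≠ 0)
    {x y : AlgebraicClosure ℚ} {h : (W.baseChange (AlgebraicClosure ℚ)).toAffine.Nonsingular x y}
    (hP : (P : W.geomPoints) = Affine.Point.some x y h) (hx : 1 < (placeOver p).valuation x)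
    {F : ℚ[X]} (hF : aeval x F = 0) (hneg : ∀ r : ℝ, aeval r F = 0 → aeval r W.Ψ₂Sq < 0) :
    ¬ GVPar W p := by
  have hram := (not_lineUnramifiedAt_iff_one_lt_valuation hΦ hp2 hgood hord hPΦ hP0 hP).mpr hx
  have hodd := lineOdd_of_forall_real_root_neg hΦ hp2 hPΦ hP0 hP hF hneg
  refine not_gvPar_of_isRationalLine hp2 hgood hord hΦ ?_
  rintro (⟨-, he⟩ | ⟨hu, -⟩)
  · exact lineEven_lineOdd_false hp2 hΦ he hodd
  · exact hram hu

/-- **Type A from an UNRAMIFIED EVEN line**: `v_𝔓(x) ≤ 1` and `Ψ₂Sq > 0` at every real root of an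
`F ∈ ℚ[X]` vanishing at `x` ⇒ `¬ GVPar W p` (good ordinary odd `p`). [folklore] -/
theorem not_gvPar_of_valuation_le_one_of_forall_real_root_pos (hΦ : IsRationalLine W p Φ)
    (hp2 : p ≠ 2) (hgood : W.HasGoodReductionAtPrime p) (hord : ¬ (p : ℤ) ∣ W.frobeniusTrace p)
    {P : geomTorsion W (p : ℤ)} (hPΦ : P ∈ Φ) (hP0 : P ≠ 0)
    {x y : AlgebraicClosure ℚ} {h : (W.baseChange (AlgebraicClosure ℚ)).toAffine.Nonsingular x y}
    (hP : (P : W.geomPoints) = Affine.Point.some x y h) (hx : (placeOver p).valuation x ≤ 1)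
    {F : ℚ[X]} (hF : aeval x F = 0) (hpos : ∀ r : ℝ, aeval r F = 0 → 0 < aeval r W.Ψ₂Sq) :
    ¬ GVPar W p := by
  have hunr := (lineUnramifiedAt_iff_valuation_le_one hΦ hp2 hgood hord hPΦ hP0 hP).mpr hx
  have heven := lineEven_of_forall_real_root_pos hΦ hp2 hPΦ hP0 hP hF hpos
  refine not_gvPar_of_isRationalLine hp2 hgood hord hΦ ?_
  rintro (⟨hr, -⟩ | ⟨-, ho⟩)
  · exact hr hunr
  · exact lineEven_lineOdd_false hp2 hΦ heven ho

/-- **The four-way table.** At a good ordinary odd `p`, for any rational line and non-zero point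
`P = (x, y)` with embedded real abscissa `r`: exactly one of (ramified, even) [type B],
(unramified, odd) [type B], (unramified, even) [type A], (ramified, odd) [type A] holds, read as
(`1 < v_𝔓(x)`, `0 < Ψ₂Sq(r)`), (`v_𝔓(x) ≤ 1`, `Ψ₂Sq(r) < 0`), (`v_𝔓(x) ≤ 1`, `0 < Ψ₂Sq(r)`),
(`1 < v_𝔓(x)`, `Ψ₂Sq(r) < 0`); here: `¬ GVPar W p ↔ (1 < v_𝔓(x) ↔ Ψ₂Sq(r) < 0)`. [folklore] -/
theorem not_gvPar_iff_valuation_iff_aeval_real_neg (hΦ : IsRationalLine W p Φ) (hp2 : p ≠ 2)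
    (hgood : W.HasGoodReductionAtPrime p) (hord : ¬ (p : ℤ) ∣ W.frobeniusTrace p)
    {P : geomTorsion W (p : ℤ)} (hPΦ : P ∈ Φ) (hP0 : P ≠ 0)
    {x y : AlgebraicClosure ℚ} {h : (W.baseChange (AlgebraicClosure ℚ)).toAffine.Nonsingular x y}
    (hP : (P : W.geomPoints) = Affine.Point.some x y h)
    {c : absoluteGaloisGroup ℚ} (hc : IsComplexConjugation (Rat.castHom ℝ) c)
    {ι : AlgebraicClosure ℚ →+* ℂ} (hι : ∀ z, ι (c • z) = conj (ι z)) {r : ℝ} (hr : ι x = r) :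
    ¬ GVPar W p ↔ (1 < (placeOver p).valuation x ↔ aeval r W.Ψ₂Sq < 0) := by
  rw [gvPar_iff_valuation_iff_aeval_real_pos hΦ hp2 hgood hord hPΦ hP0 hP hc hι hr]
  -- `Ψ₂Sq(r) ≠ 0`
  have hne : aeval r W.Ψ₂Sq ≠ 0 := by
    rcases lineEven_or_lineOdd hΦ with he | ho
    · exact ((lineEven_iff_aeval_real_pos hΦ hp2 hPΦ hP0 hP hc hι hr).mp he).ne'
    · exact ((lineOdd_iff_aeval_real_neg hΦ hp2 hPΦ hP0 hP hc hι hr).mp ho).ne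
  rcases lt_or_gt_of_ne hne with hlt | hgt
  · simp only [hlt, not_lt.mpr hlt.le, iff_false, iff_true, not_not]
  · simp only [hgt, not_lt.mpr hgt.le, iff_true, iff_false]

/-! ### The ramified certificate in power form (canonical-subgroup abscissas at `p ≥ 5`) -/

omit [W.IsElliptic] [W.IsGloballyMinimal] in
/-- **Non-integrality certificate, power form**: if `x^k · p · s = d` with `s` integral over `ℤ` and
`d` an integer prime to `p`, then `v_𝔓(x) > 1` (`k = 0` is contradictory). (For the abscissa of a
canonical-subgroup point at a good ordinary `p`, `|x|_𝔓 = |p|^{-2/(p-1)}`, so `k = p - 1` works with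
`|s|_𝔓 = |p|`; the case `k = 1` of file 2, `not_lineUnramifiedAt_of_isIntegral_inv`, needs `|s| ≤ 1`
and therefore only serves `p = 3`.) [folklore] -/
theorem one_lt_valuation_of_pow_mul_eq {x s : AlgebraicClosure ℚ} {k : ℕ}
    (hs : IsIntegral ℤ s) {d : ℤ} (hd : ¬ (p : ℤ) ∣ d)
    (hx : x ^ k * ((p : AlgebraicClosure ℚ) * s) = d) : 1 < (placeOver p).valuation x := by
  have hsle : (placeOver p).valuation s ≤ 1 :=
    (Valuation.mem_integer_iff _ _).mp
      ((integers_placeOver p).mem_of_integral (isIntegral_placeOver_of_isIntegral_int hs))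
  have hplt : (placeOver p).valuation ((p : ℕ) : AlgebraicClosure ℚ) < 1 :=
    valuation_placeOver_natCast_lt_one p
  have hprod : (placeOver p).valuation x ^ k * ((placeOver p).valuation ((p : ℕ) : AlgebraicClosure ℚ) *
      (placeOver p).valuation s) = 1 := by
    rw [← map_pow, ← map_mul, ← map_mul, hx]
    exact valuation_placeOver_intCast_eq_one p hd
  by_contra hle
  exact absurd hprod (mul_lt_one_of_nonneg_of_lt_one_right (pow_le_one₀ zero_le (not_lt.mp hle))
    zero_le (mul_lt_one_of_nonneg_of_lt_one_left zero_le hplt hsle)).ne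

/-- **Ramified certificate, power form** (good ordinary odd `p`): `x^k · p · s = d` as above for the
abscissa `x` of a non-zero point of the rational line `Φ` ⇒ `Φ` is ramified at `p`. [folklore] -/
theorem not_lineUnramifiedAt_of_pow_mul_eq (hΦ : IsRationalLine W p Φ) (hp2 : p ≠ 2)
    (hgood : W.HasGoodReductionAtPrime p) (hord : ¬ (p : ℤ) ∣ W.frobeniusTrace p)
    {P : geomTorsion W (p : ℤ)} (hPΦ : P ∈ Φ) (hP0 : P ≠ 0)
    {x y : AlgebraicClosure ℚ} {h : (W.baseChange (AlgebraicClosure ℚ)).toAffine.Nonsingular x y}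
    (hP : (P : W.geomPoints) = Affine.Point.some x y h) {s : AlgebraicClosure ℚ} {k : ℕ}
    (hs : IsIntegral ℤ s) {d : ℤ} (hd : ¬ (p : ℤ) ∣ d) (hx : x ^ k * ((p : AlgebraicClosure ℚ) * s) = d) :
    ¬ LineUnramifiedAt W p Φ :=
  (not_lineUnramifiedAt_iff_one_lt_valuation hΦ hp2 hgood hord hPΦ hP0 hP).mpr
    (one_lt_valuation_of_pow_mul_eq hs hd hx)

end KernelDisc

end Summit.BirchSwinnertonDyer.Rank1Residual

end
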